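import Summits.HubbardSuperconductivity.HubbardSuperconductivity.Theorems.BalabanIRBirBdGPhaseCoercivityModes
import Summits.HubbardSuperconductivity.HubbardSuperconductivity.Theorems.BalabanIRBirBdGPhaseCoercivityTrigPoly

/-!
# Route BalabanIR — crux 3 `BirBdGPhaseCoercivity` (item `stmt-HubbardSuperconductivity-2081`):
# the Lyapunov deficit bound on the torus — the nearest-neighbour pair amplitude

THEOREM (`lyap_bond`). With the symbols `ξ_k, Δ_k, E_k` of the crux's stencils, `0 < E_k ≤ E_max`,
`L ≥ 3`, `u = e^{iθ}` and the position-space anomalous amplitude `F = N⁻¹ Wᴴ diag(Δ/E) W`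
(`F_{xy} = f(x - y)`, `f(z) = N⁻¹ Σ_k (Δ_k/E_k) χ_k(z)`):
  `(2 Δ₁² / E_max²) Σ_x Σ_{y ∼ x} (1 - cos(θ_x - θ_y)) ≤ Σ_{x,y} |F_{xy}|² |u_y - u_x|²`.
PROOF. Keep only the four nearest-neighbour terms `y = x ± e_i` of the right-hand side;
`|u_y - u_x|² = 2(1 - cos(θ_x - θ_y))` and the shift `x ↦ x + e_i` pair the `± e_i` terms:
`Σ ≥ Σ_i 2(|f(e_i)|² + |f(-e_i)|²) R_i ≥ Σ_i (Re (f(e_i) + f(-e_i)))² R_i`,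
`R_i = Σ_x (1 - cos(θ_x - θ_{x+e_i}))`, `Σ_x Σ_{y∼x} (1 - cos) = 2R₀ + 2R₁`. By the characters at
`± e_i` and `Re Δ_k = 2Δ₁ (cos p₀ - cos p₁)`, `Re (f(e_i) + f(-e_i)) = (4Δ₁/N) G_i`,
`G_i = Σ_k cos pᵢ (cos p₀ - cos p₁)/E_k`; the swap `k ↦ (k₁, k₀)` gives `G₁ = -G₀`, so
`G₀ = ½ Σ_k (cos p₀ - cos p₁)²/E_k ≥ N/(2 E_max)` by the exact lattice sum
`Σ_k (cos p₀ - cos p₁)² = N` (`L ≥ 3`, aliasing-free orthogonality of the file `…TrigPoly`).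
No definition is introduced.
-/

noncomputable section

namespace Summit.HubbardSuperconductivity.HubbardSuperconductivity.Theorems

namespace BirBdG

open Matrix Finset Literature.Probability.LatticeModels
open scoped ComplexConjugate

variable {L : ℕ} [NeZero L]

/-! ### Elementary pieces -/

omit [NeZero L] in
/-- `|e^{ib} - e^{ia}|² = 2 (1 - cos (a - b))`. [folklore] -/
theorem lyap_norm_exp_sub_sq (a b : ℝ) :
    ‖Complex.exp (Complex.I * (b : ℂ)) - Complex.exp (Complex.I * (a : ℂ))‖ ^ 2 =
      2 * (1 - Real.cos (a - b)) := by
  rw [mul_comm Complex.I (b : ℂ), mul_comm Complex.I (a : ℂ), Complex.sq_norm, Complex.normSq_apply,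
    Complex.sub_re, Complex.sub_im, Complex.exp_ofReal_mul_I_re, Complex.exp_ofReal_mul_I_re,
    Complex.exp_ofReal_mul_I_im, Complex.exp_ofReal_mul_I_im, Real.cos_sub]
  have ha := Real.sin_sq_add_cos_sq a
  have hb := Real.sin_sq_add_cos_sq b
  linear_combination ha + hb

/-- Entries of the inverse plane-wave transform of a multiplier: `(N⁻¹ Wᴴ diag(g) W)_{xy} =
N⁻¹ Σ_k g_k χ_k(x - y)`. [cite: FriedliVelenik2017, §10.4] -/
theorem lyap_unhat_diagonal_apply {d : ℕ} (g : TorusSite d L → ℂ) (x y : TorusSite d L) :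
    (((L ^ d : ℕ) : ℂ)⁻¹ • ((Matrix.of fun k x : TorusSite d L => conj (torusChar k x))ᴴ *
        Matrix.diagonal g * Matrix.of (fun k x : TorusSite d L => conj (torusChar k x)))) x y =
      ((L ^ d : ℕ) : ℂ)⁻¹ * ∑ k, g k * torusChar k (x - y) := by
  rw [Matrix.smul_apply, smul_eq_mul, Matrix.mul_apply]
  congr 1
  refine Finset.sum_congr rfl fun k _ => ?_
  rw [Matrix.mul_diagonal]
  simp only [Matrix.conjTranspose_apply, Matrix.of_apply, Complex.star_def, Complex.conj_conj]
  rw [torusChar_sub_right]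
  ring

/-- Shift of the bond sum: `Σ_x (1 - cos(θ_x - θ_{x - e})) = Σ_x (1 - cos(θ_x - θ_{x + e}))`. [folklore] -/
theorem lyap_sum_shift (θ : TorusSite 2 L → ℝ) (e : TorusSite 2 L) :
    ∑ x, (1 - Real.cos (θ x - θ (x + -e))) = ∑ x, (1 - Real.cos (θ x - θ (x + e))) := by
  rw [← Equiv.sum_comp (Equiv.addRight e)]
  refine Finset.sum_congr rfl fun x _ => ?_
  simp only [Equiv.coe_addRight, add_neg_cancel_right]
  rw [← Real.cos_neg, neg_sub]

/-- `|a|² + |b|² ≥ ½ (Re (a + b))²`. [folklore] -/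
theorem lyap_normSq_add_normSq_ge (a b : ℂ) : (a + b).re ^ 2 / 2 ≤ ‖a‖ ^ 2 + ‖b‖ ^ 2 := by
  have h1 : |(a + b).re| ≤ ‖a + b‖ := Complex.abs_re_le_norm _
  have h2 : ‖a + b‖ ≤ ‖a‖ + ‖b‖ := norm_add_le a b
  have h3 : (a + b).re ^ 2 ≤ (‖a‖ + ‖b‖) ^ 2 := by
    rw [← sq_abs]
    exact pow_le_pow_left₀ (abs_nonneg _) (h1.trans h2) 2
  nlinarith [norm_nonneg a, norm_nonneg b, sq_nonneg (‖a‖ - ‖b‖)]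

/-! ### Lattice trigonometric sums -/

/-- `Σ_k cos(2 pᵢ) = 0` and `Σ_k cos(p₀ ± p₁) = 0` on `(ℤ/L)²` for `L ≥ 3` (aliasing-free
orthogonality at the integer frequencies `(2,0), (0,2), (1,1), (1,-1)`). [cite: FriedliVelenik2017, §10.4] -/
theorem lyap_trig_sums (hL : 3 ≤ L) :
    (∑ k : TorusSite 2 L, Real.cos (2 * latticeMomentum L k 0) = 0) ∧
    (∑ k : TorusSite 2 L, Real.cos (2 * latticeMomentum L k 1) = 0) ∧
    (∑ k : TorusSite 2 L, Real.cos (latticeMomentum L k 0 + latticeMomentum L k 1) = 0) ∧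
    (∑ k : TorusSite 2 L, Real.cos (latticeMomentum L k 0 - latticeMomentum L k 1) = 0) := by
  have hL' : (3 : ℤ) ≤ (L : ℤ) := by exact_mod_cast hL
  have key : ∀ ρ : ℤ × ℤ, ρ ≠ 0 → |ρ.1| < L → |ρ.2| < L →
      ∑ k : TorusSite 2 L, Real.cos (ρ.1 * latticeMomentum L k 0 + ρ.2 * latticeMomentum L k 1) = 0 := by
    intro ρ hρ h0 h1
    have hs := sum_torusChar_intFreq (L := L) ρ h0 h1
    rw [if_neg hρ] at hs
    have hre := congrArg Complex.re hs
    rw [Complex.re_sum, Complex.zero_re] at hre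
    rw [← hre]
    refine Finset.sum_congr rfl fun k _ => ?_
    rw [torusChar_intFreq_eq_exp, mul_comm Complex.I, Complex.exp_ofReal_mul_I_re]
  refine ⟨?_, ?_, ?_, ?_⟩
  · have := key (2, 0) (by simp) (by simp only; rw [abs_two]; omega) (by simp only [abs_zero]; omega)
    simpa using this
  · have := key (0, 2) (by simp) (by simp only [abs_zero]; omega) (by simp only; rw [abs_two]; omega)
    simpa using this
  · have := key (1, 1) (by simp) (by simp only [abs_one]; omega) (by simp only [abs_one]; omega)
    simpa using this
  · have := key (1, -1) (by simp) (by simp only [abs_one]; omega) (by simp only [abs_neg, abs_one]; omega)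
    simpa [sub_eq_add_neg] using this

/-- **The exact lattice sum** `Σ_k (cos p₀ - cos p₁)² = L²` for `L ≥ 3`. [cite: FriedliVelenik2017, §10.4] -/
theorem lyap_sum_cos_sub_sq (hL : 3 ≤ L) :
    ∑ k : TorusSite 2 L, (Real.cos (latticeMomentum L k 0) - Real.cos (latticeMomentum L k 1)) ^ 2 =
      ((L ^ 2 : ℕ) : ℝ) := by
  obtain ⟨s20, s02, s11, s1m1⟩ := lyap_trig_sums hL
  have hterm : ∀ k : TorusSite 2 L,
      (Real.cos (latticeMomentum L k 0) - Real.cos (latticeMomentum L k 1)) ^ 2 =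
        1 + Real.cos (2 * latticeMomentum L k 0) / 2 + Real.cos (2 * latticeMomentum L k 1) / 2 -
          (Real.cos (latticeMomentum L k 0 + latticeMomentum L k 1) +
            Real.cos (latticeMomentum L k 0 - latticeMomentum L k 1)) := by
    intro k
    rw [Real.cos_add, Real.cos_sub, Real.cos_two_mul, Real.cos_two_mul]
    ring
  simp_rw [hterm]
  rw [Finset.sum_sub_distrib, Finset.sum_add_distrib, Finset.sum_add_distrib, Finset.sum_add_distrib,
    ← Finset.sum_div, ← Finset.sum_div, s20, s02, s11, s1m1, Finset.sum_const, Finset.card_univ,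
    Fintype.card_fun, ZMod.card, Fintype.card_fin]
  push_cast
  ring

/-! ### The theorem -/

/-- **The nearest-neighbour pair amplitude bound.** See the module docstring. [folklore] -/
theorem lyap_bond {L : ℕ} [NeZero L] (μ Δ₁ Δ₂ Emax : ℝ) (hL : 3 ≤ L) (ξ E : TorusSite 2 L → ℝ) (Δ : TorusSite 2 L → ℂ) (hξ : ∀ k, ξ k = -2 * Real.cos (latticeMomentum L k 0) - 2 * Real.cos (latticeMomentum L k 1) - μ) (hΔ : ∀ k, Δ k = ((2 * Δ₁ * (Real.cos (latticeMomentum L k 0) - Real.cos (latticeMomentum L k 1)) : ℝ) : ℂ) - 4 * Complex.I * ((Δ₂ * Real.sin (latticeMomentum L k 0) * Real.sin (latticeMomentum L k 1) : ℝ) : ℂ)) (hE : ∀ k, E k = Real.sqrt (ξ k ^ 2 + ‖Δ k‖ ^ 2)) (hEpos : ∀ k, 0 < E k) (hEmax : ∀ k, E k ≤ Emax) (θ : TorusSite 2 L → ℝ) : 2 * Δ₁ ^ 2 / Emax ^ 2 * ∑ x : TorusSite 2 L, ∑ y : TorusSite 2 L, (if ((y = x + ![1, 0] ∨ y = x + ![-1,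 0]) ∨ (y = x + ![0, 1] ∨ y = x + ![0, -1])) then (1 - Real.cos (θ x - θ y)) else 0) ≤ ∑ x : TorusSite 2 L, ∑ y : TorusSite 2 L, ‖(((L ^ 2 : ℕ) : ℂ)⁻¹ • ((Matrix.of fun k x : TorusSite 2 L => conj (torusChar k x))ᴴ * Matrix.diagonal (fun k => Δ k / (E k : ℂ)) * Matrix.of (fun k x : TorusSite 2 L => conj (torusChar k x)))) x y‖ ^ 2 * ‖Complex.exp (Complex.I * (θ y : ℂ)) - Complex.exp (Complex.I * (θ x : ℂ))‖ ^ 2 := by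
  have hN : ((L ^ 2 : ℕ) : ℝ) ≠ 0 := by exact_mod_cast pow_ne_zero 2 (NeZero.ne L)
  have hNpos : (0 : ℝ) < ((L ^ 2 : ℕ) : ℝ) := by exact_mod_cast pow_pos (Nat.pos_of_ne_zero (NeZero.ne L)) 2
  have hEmaxpos : 0 < Emax := lt_of_lt_of_le (hEpos 0) (hEmax 0)
  -- the anomalous amplitude as a function of the bond vector
  set f : TorusSite 2 L → ℂ := fun z => ((L ^ 2 : ℕ) : ℂ)⁻¹ * ∑ k, Δ k / (E k : ℂ) * torusChar k z
    with hf
  have hF : ∀ x y, (((L ^ 2 : ℕ) : ℂ)⁻¹ • ((Matrix.of fun k x : TorusSite 2 L => conj (torusChar k x))ᴴ *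
      Matrix.diagonal (fun k => Δ k / (E k : ℂ)) *
      Matrix.of (fun k x : TorusSite 2 L => conj (torusChar k x)))) x y = f (x - y) := by
    intro x y
    rw [lyap_unhat_diagonal_apply]
  -- bond sums `R_e`
  set c : TorusSite 2 L → TorusSite 2 L → ℝ := fun x y => 1 - Real.cos (θ x - θ y) with hc
  have hcnn : ∀ x y, 0 ≤ c x y := fun x y => by
    rw [hc]
    dsimp only
    linarith [Real.cos_le_one (θ x - θ y)]
  set R0 : ℝ := ∑ x, c x (x + Pi.single 0 1) with hR0
  set R1 : ℝ := ∑ x, c x (x + Pi.single 1 1) with hR1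
  have hR0nn : 0 ≤ R0 := Finset.sum_nonneg fun x _ => hcnn _ _
  have hR1nn : 0 ≤ R1 := Finset.sum_nonneg fun x _ => hcnn _ _
  have hR0' : ∑ x, c x (x + -Pi.single 0 1) = R0 := lyap_sum_shift θ _
  have hR1' : ∑ x, c x (x + -Pi.single 1 1) = R1 := lyap_sum_shift θ _
  -- the crux's functional is `2 R₀ + 2 R₁`
  have hR : ∑ x : TorusSite 2 L, ∑ y : TorusSite 2 L,
      (if ((y = x + ![1, 0] ∨ y = x + ![-1, 0]) ∨ (y = x + ![0, 1] ∨ y = x + ![0, -1]))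
        then (1 - Real.cos (θ x - θ y)) else 0) = 2 * R0 + 2 * R1 := by
    simp_rw [sum_ite_nn_eq hL _ (fun y => 1 - Real.cos (θ _ - θ y))]
    rw [Finset.sum_add_distrib, Finset.sum_add_distrib, Finset.sum_add_distrib]
    change ∑ x, c x (x + Pi.single 0 1) + ∑ x, c x (x + -Pi.single 0 1) +
      ∑ x, c x (x + Pi.single 1 1) + ∑ x, c x (x + -Pi.single 1 1) = 2 * R0 + 2 * R1
    rw [hR0', hR1']
    ring
  -- keep the four nearest-neighbour terms of the right-hand side
  have hrhs : ∑ x : TorusSite 2 L, ∑ y : TorusSite 2 L, ‖f (x - y)‖ ^ 2 *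
        ‖Complex.exp (Complex.I * (θ y : ℂ)) - Complex.exp (Complex.I * (θ x : ℂ))‖ ^ 2 ≥
      2 * (‖f (-Pi.single 0 1)‖ ^ 2 + ‖f (Pi.single 0 1)‖ ^ 2) * R0 +
        2 * (‖f (-Pi.single 1 1)‖ ^ 2 + ‖f (Pi.single 1 1)‖ ^ 2) * R1 := by
    have hxy : ∀ x y, ‖f (x - y)‖ ^ 2 *
        ‖Complex.exp (Complex.I * (θ y : ℂ)) - Complex.exp (Complex.I * (θ x : ℂ))‖ ^ 2 =
        2 * (‖f (x - y)‖ ^ 2 * c x y) := by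
      intro x y
      rw [lyap_norm_exp_sub_sq]
      ring
    simp_rw [hxy]
    have hlow : ∀ x : TorusSite 2 L,
        ∑ y, (if ((y = x + ![1, 0] ∨ y = x + ![-1, 0]) ∨ (y = x + ![0, 1] ∨ y = x + ![0, -1]))
          then 2 * (‖f (x - y)‖ ^ 2 * c x y) else 0) ≤ ∑ y, 2 * (‖f (x - y)‖ ^ 2 * c x y) := by
      intro x
      refine Finset.sum_le_sum fun y _ => ?_
      split_ifs
      · exact le_rfl
      · exact mul_nonneg (by norm_num) (mul_nonneg (sq_nonneg _) (hcnn x y))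
    have hsum := Finset.sum_le_sum fun x (_ : x ∈ Finset.univ) => hlow x
    refine le_trans (le_of_eq ?_) hsum
    simp_rw [sum_ite_nn_eq hL _ (fun y => 2 * (‖f (_ - y)‖ ^ 2 * c _ y))]
    rw [Finset.sum_add_distrib, Finset.sum_add_distrib, Finset.sum_add_distrib]
    have e1 : ∑ x, 2 * (‖f (-Pi.single 0 1)‖ ^ 2 * c x (x + Pi.single 0 1)) =
        2 * ‖f (-Pi.single 0 1)‖ ^ 2 * R0 := by rw [hR0, Finset.mul_sum]; exact Finset.sum_congr rfl fun x _ => by ring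
    have e2 : ∑ x, 2 * (‖f (- -Pi.single 0 1)‖ ^ 2 * c x (x + -Pi.single 0 1)) =
        2 * ‖f (Pi.single 0 1)‖ ^ 2 * R0 := by
      rw [neg_neg, ← hR0', Finset.mul_sum]; exact Finset.sum_congr rfl fun x _ => by ring
    have e3 : ∑ x, 2 * (‖f (-Pi.single 1 1)‖ ^ 2 * c x (x + Pi.single 1 1)) =
        2 * ‖f (-Pi.single 1 1)‖ ^ 2 * R1 := by rw [hR1, Finset.mul_sum]; exact Finset.sum_congr rfl fun x _ => by ring
    have e4 : ∑ x, 2 * (‖f (- -Pi.single 1 1)‖ ^ 2 * c x (x + -Pi.single 1 1)) =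
        2 * ‖f (Pi.single 1 1)‖ ^ 2 * R1 := by
      rw [neg_neg, ← hR1', Finset.mul_sum]; exact Finset.sum_congr rfl fun x _ => by ring
    simp only [show ∀ x (e : TorusSite 2 L), x - (x + e) = -e from fun x e => by abel] at *
    rw [e1, e2, e3, e4]
    ring
  -- the symmetric sums `f(e) + f(-e)` and their real parts
  have hpair : ∀ i : Fin 2, f (Pi.single i 1) + f (-Pi.single i 1) =
      ((L ^ 2 : ℕ) : ℂ)⁻¹ * ∑ k, Δ k / (E k : ℂ) * ((2 * Real.cos (latticeMomentum L k i) : ℝ) : ℂ) := by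
    intro i
    rw [hf]
    dsimp only
    rw [← mul_add, ← Finset.sum_add_distrib]
    congr 1
    refine Finset.sum_congr rfl fun k _ => ?_
    rw [← mul_add, torusChar_neg_right, torusChar_single_add_conj']
  have hΔre : ∀ k, (Δ k).re = 2 * Δ₁ * (Real.cos (latticeMomentum L k 0) - Real.cos (latticeMomentum L k 1)) := by
    intro k
    rw [hΔ, Complex.sub_re, Complex.ofReal_re]
    simp [Complex.mul_re, Complex.mul_im]
  set G : Fin 2 → ℝ := fun i => ∑ k : TorusSite 2 L, Real.cos (latticeMomentum L k i) *
    (Real.cos (latticeMomentum L k 0) - Real.cos (latticeMomentum L k 1)) / E k with hG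
  have hre : ∀ i : Fin 2, (f (Pi.single i 1) + f (-Pi.single i 1)).re =
      ((L ^ 2 : ℕ) : ℝ)⁻¹ * (4 * Δ₁ * G i) := by
    intro i
    rw [hpair, show (((L ^ 2 : ℕ) : ℂ))⁻¹ = ((((L ^ 2 : ℕ) : ℝ)⁻¹ : ℝ) : ℂ) by push_cast; rfl,
      Complex.re_ofReal_mul, Complex.re_sum, hG]
    congr 1
    dsimp only
    rw [Finset.mul_sum]
    refine Finset.sum_congr rfl fun k _ => ?_
    rw [Complex.mul_re, Complex.ofReal_re, Complex.ofReal_im, mul_zero, sub_zero,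
      Complex.div_ofReal_re, hΔre]
    field_simp
    ring
  -- the swap symmetry `G 1 = -G 0`
  have hsw0 : ∀ k : TorusSite 2 L, latticeMomentum L (k ∘ ⇑(Equiv.swap (0 : Fin 2) 1)) 0 =
      latticeMomentum L k 1 := fun k => by
    simp [latticeMomentum, Function.comp, Equiv.swap_apply_left]
  have hsw1 : ∀ k : TorusSite 2 L, latticeMomentum L (k ∘ ⇑(Equiv.swap (0 : Fin 2) 1)) 1 =
      latticeMomentum L k 0 := fun k => by
    simp [latticeMomentum, Function.comp, Equiv.swap_apply_right]
  have hswapE : ∀ k : TorusSite 2 L, E (k ∘ ⇑(Equiv.swap (0 : Fin 2) 1)) = E k := by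
    intro k
    rw [hE, hE, hξ, hξ, hΔ, hΔ, hsw0, hsw1]
    congr 1
    have hn : ‖((2 * Δ₁ * (Real.cos (latticeMomentum L k 1) - Real.cos (latticeMomentum L k 0)) : ℝ) : ℂ) -
        4 * Complex.I * ((Δ₂ * Real.sin (latticeMomentum L k 1) * Real.sin (latticeMomentum L k 0) : ℝ) : ℂ)‖ =
        ‖((2 * Δ₁ * (Real.cos (latticeMomentum L k 0) - Real.cos (latticeMomentum L k 1)) : ℝ) : ℂ) -
        4 * Complex.I * ((Δ₂ * Real.sin (latticeMomentum L k 0) * Real.sin (latticeMomentum L k 1) : ℝ) : ℂ)‖ := by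
      rw [← norm_neg, ← Complex.norm_conj]
      congr 1
      simp only [map_neg, map_sub, map_mul, Complex.conj_ofReal, Complex.conj_I, Complex.conj_ofNat]
      push_cast
      ring
    rw [hn]
    ring
  have hswap : G 1 = -G 0 := by
    rw [hG]
    dsimp only
    rw [← Equiv.sum_comp ((Equiv.swap (0 : Fin 2) 1).arrowCongr (Equiv.refl (ZMod L))),
      ← Finset.sum_neg_distrib]
    refine Finset.sum_congr rfl fun k _ => ?_
    have hk : ((Equiv.swap (0 : Fin 2) 1).arrowCongr (Equiv.refl (ZMod L))) k =
        k ∘ ⇑(Equiv.swap (0 : Fin 2) 1) := by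
      funext i
      simp [Equiv.arrowCongr_apply, Equiv.symm_swap]
    rw [hk, hswapE k, hsw0, hsw1]
    ring
  -- `G 0 = ½ Σ (cos p₀ - cos p₁)²/E ≥ N/(2 E_max)`
  have hG0 : 2 * G 0 = ∑ k : TorusSite 2 L,
      (Real.cos (latticeMomentum L k 0) - Real.cos (latticeMomentum L k 1)) ^ 2 / E k := by
    have : G 0 - G 1 = ∑ k : TorusSite 2 L,
        (Real.cos (latticeMomentum L k 0) - Real.cos (latticeMomentum L k 1)) ^ 2 / E k := by
      rw [hG]
      dsimp only
      rw [← Finset.sum_sub_distrib]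
      refine Finset.sum_congr rfl fun k _ => ?_
      ring
    linarith [this, hswap]
  have hG0low : ((L ^ 2 : ℕ) : ℝ) / Emax ≤ 2 * G 0 := by
    rw [hG0, ← lyap_sum_cos_sub_sq hL, Finset.sum_div]
    refine Finset.sum_le_sum fun k _ => ?_
    exact div_le_div_of_nonneg_left (sq_nonneg _) (hEpos k) (hEmax k)
  have hG0pos : 0 ≤ G 0 := by
    have : 0 < ((L ^ 2 : ℕ) : ℝ) / Emax := div_pos hNpos hEmaxpos
    linarith
  -- assemble
  have hsq0 : (f (Pi.single 0 1) + f (-Pi.single 0 1)).re ^ 2 = ((L ^ 2 : ℕ) : ℝ)⁻¹ ^ 2 * (16 * Δ₁ ^ 2 * G 0 ^ 2) := by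
    rw [hre]; ring
  have hsq1 : (f (Pi.single 1 1) + f (-Pi.single 1 1)).re ^ 2 = ((L ^ 2 : ℕ) : ℝ)⁻¹ ^ 2 * (16 * Δ₁ ^ 2 * G 0 ^ 2) := by
    rw [hre, hswap]; ring
  have hp0 := lyap_normSq_add_normSq_ge (f (-Pi.single 0 1)) (f (Pi.single 0 1))
  have hp1 := lyap_normSq_add_normSq_ge (f (-Pi.single 1 1)) (f (Pi.single 1 1))
  rw [add_comm (f (-Pi.single 0 1)), hsq0] at hp0
  rw [add_comm (f (-Pi.single 1 1)), hsq1] at hp1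
  simp_rw [hF]
  rw [hR]
  refine le_trans ?_ hrhs
  -- `2 Δ₁²/E_max² (2R₀ + 2R₁) ≤ Σ_i 2 (|f(e_i)|² + |f(-e_i)|²) 2Rᵢ`, using `G 0 ≥ N/(2 E_max)`
  have hGsq : (((L ^ 2 : ℕ) : ℝ) / Emax) ^ 2 ≤ (2 * G 0) ^ 2 :=
    pow_le_pow_left₀ (div_nonneg hNpos.le hEmaxpos.le) hG0low 2
  have hN2 : ((L ^ 2 : ℕ) : ℝ) ^ 2 ≤ (2 * G 0) ^ 2 * Emax ^ 2 := by
    rw [div_pow] at hGsq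
    exact (div_le_iff₀ (by positivity)).1 hGsq
  have hkey : 2 * Δ₁ ^ 2 / Emax ^ 2 * 2 ≤ 2 * (((L ^ 2 : ℕ) : ℝ)⁻¹ ^ 2 * (16 * Δ₁ ^ 2 * G 0 ^ 2) / 2) := by
    have e : 2 * (((L ^ 2 : ℕ) : ℝ)⁻¹ ^ 2 * (16 * Δ₁ ^ 2 * G 0 ^ 2) / 2) =
        16 * Δ₁ ^ 2 * G 0 ^ 2 / ((L ^ 2 : ℕ) : ℝ) ^ 2 := by
      field_simp
    rw [e, show 2 * Δ₁ ^ 2 / Emax ^ 2 * 2 = 4 * Δ₁ ^ 2 / Emax ^ 2 by ring,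
      div_le_div_iff₀ (by positivity) (by positivity)]
    have h4 := mul_le_mul_of_nonneg_left hN2 (by positivity : (0 : ℝ) ≤ 4 * Δ₁ ^ 2)
    calc 4 * Δ₁ ^ 2 * ((L ^ 2 : ℕ) : ℝ) ^ 2 ≤ 4 * Δ₁ ^ 2 * ((2 * G 0) ^ 2 * Emax ^ 2) := h4
      _ = 16 * Δ₁ ^ 2 * G 0 ^ 2 * Emax ^ 2 := by ring
  calc 2 * Δ₁ ^ 2 / Emax ^ 2 * (2 * R0 + 2 * R1)
      = (2 * Δ₁ ^ 2 / Emax ^ 2 * 2) * R0 + (2 * Δ₁ ^ 2 / Emax ^ 2 * 2) * R1 := by ring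
    _ ≤ 2 * (((L ^ 2 : ℕ) : ℝ)⁻¹ ^ 2 * (16 * Δ₁ ^ 2 * G 0 ^ 2) / 2) * R0 +
        2 * (((L ^ 2 : ℕ) : ℝ)⁻¹ ^ 2 * (16 * Δ₁ ^ 2 * G 0 ^ 2) / 2) * R1 := by
        gcongr
    _ ≤ 2 * (‖f (-Pi.single 0 1)‖ ^ 2 + ‖f (Pi.single 0 1)‖ ^ 2) * R0 +
        2 * (‖f (-Pi.single 1 1)‖ ^ 2 + ‖f (Pi.single 1 1)‖ ^ 2) * R1 := by
        gcongr

end BirBdG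

end Summit.HubbardSuperconductivity.HubbardSuperconductivity.Theorems

end
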